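import Summits.QuantumFields.YangMills.Theorems.BalabanUVNodesN22W1StripTermIndexedKeyed
import Literature.MathematicalPhysics.QuantumFieldTheory.Balaban1983to89.Node00.HistoryTermDatum214

/-!
# BalabanUVNodes ∕ node N22 = NE9 — THE STRIP INDUCTION AT THE W1 OBJECT, MODULE 25′: THE LEAF AT THE (2.14) TERM DATUM — node00-def-W1 g7's
# `W1.TermData214` (NODE A's kernels, the characteristic functions at the coupling, Lemma 2's potentials 𝐕_k AS A FUNCTION OF THE HISTORY; `𝔇.TF` = print's
# display (2.14), `𝔇.Gn := GenTower.ofTerms L 𝔇.TF`): per-term locality DISCHARGED from a locality law of the potentials on the space tables; the remaining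
# analytic inputs are (2.26) + holomorphy FOR THE (2.14) TERM OF THE DATUM in the complex older terms ∕ the complex last coupling

Cell `pub-ymgap`, HUMAN RULING D-0062 (Track A), R134 ACCELERATION re-seat `pub-ymgap-dag-n22-c` (strategy s1), generation 5, module 25′.  THEOREMS ONLY; imports module 24′
`…N22W1StripTermIndexedKeyed` (§1–§3 `…termFunEq` ∕ `n22_tupleReadingOfRecord(On)_termFun_…`; transitively 22′, 23′, n22-e's ₁₃ homes) and node00-def-W1 g7's
`Node00/HistoryTermDatum214` (`W1.TermDatum214`, `TermData214`, `TermData214.TF ∕ .Gn ∕ Gn_eq`, `TermDatum214.PotentialsLocalOn`, `TF_congr_old_of_potentialsLocalOn`,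
`norm_TF_le_weight_of_primitives`) BY NAME.  `--supports` K3‴ `SpineGivenEndpointR13` (stmt-QuantumFields-19912) as a helper.

WHY.  22′∕24′ left ONE free analytic object: a term functional `TF` with three per-term properties.  NODE 00 has now typed print's (2.14) as a DATUM
`𝔇 : W1.TermData214 c (F.P k) 𝔸 M L` whose term functional `𝔇.TF` IS the display `term214 r (Z∖Z′₀) 𝐃 (core214 A Γ (F214 |P| χ χᶜ 𝐃 𝒱)) 0 0`, and has shown that the
history enters a (2.14) term ONLY through the potentials (`TF_congr_old`): so the per-term locality (S-loc-T) of 22′ IS a locality law of Lemma 2's potentials on the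
space tables — W1 g7's hypothesis schema `PotentialsLocalOn` — and nothing else.  THIS FILE instantiates 24′ at `TF := 𝔇.TF` with that discharge: the identification becomes
`Gn F θ k = 𝔇.Gn`, (S-loc-T) becomes `(𝔇 k′).PotentialsLocalOn (U^c-tables)`, and (S-226-T) ∕ (S-last-T) are now stated FOR THE (2.14) TERM OF THE DATUM — their
(2.26) WEIGHT halves are exactly the conclusion of W1 g7's `norm_TF_le_weight_of_primitives` (one application of `B13Lemma3TorusPrimitive.h226_torus_of_primitives` at the
datum under the located primitive inputs: Lemma 2's (2.20) for 𝐕_k, (2.22) for χχᶜ, NODE A's kernel localisation, numerics), their HOLOMORPHY halves are the s1 line's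
first missing estimate as now worded ((H-old) ∕ (H-last): external-parameter holomorphy of the (2.14) term — [II] p.15 prints the internal σ(Z), τ analyticity only;
[I] p.266 asserts the analytic option without proof).

WHAT.
* §1 `n22At_u3OfRecord₁₂_ofRecordAdm_runTowers_toClusterTower_of_n18Below_termDatum214` — θ-free engine (Stage-12 tuple): generator identified at the run length
  with the datum's (`Gn k = 𝔇.Gn`), potentials local on the space tables below the run length, (S-226-T) ∕ (S-last-T) for `(𝔇 k′).TF`, N18 below, `hspk`, numerals, signs.
* §2 `n22At_u3OfRecord₁₃_…_termDatum214` — the same at one Stage-13 tuple.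
* §3 ★ `n22_tupleReadingOfRecordOn_termDatum214_of_n18Below_potentialsLocal` (guarded by any `Rg`) · ★ `n22_tupleReadingOfRecord_termDatum214_of_n18Below_potentialsLocal`
  (the K3‴ skeleton's unguarded binder «∀ F θ hP, θ.Admissible F N → ∀ g₀ os, N22At (rr F θ hP g₀ os).u3» at n22-e's witness `rr`).

HONEST FRAMING.  Count-neutral by-name knit; NOT a discharge of N22, NOT a closer of `stub_rates13`.  The datum is DATA (W1 g7: no law; Lemma 2's construction of 𝐕_k
((1.33)–(1.41)) and NODE A's kernels of record are not typed); `PotentialsLocalOn`, (S-226-T), (S-last-T) are DISPLAYED hypotheses on it — [II] (2.26) per term with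
complex parameters and the two holomorphy statements are NOT PRINTED as such; `S_N18`-below is node N18's; no inhabitant of `IsDatumOfRecord₁₃C` ∕ admissible tuple
claimed (K0‴ OPEN); vacuous where `AdmBg … = ∅` (21′ §4 names the inhabited case).  NE9 NOT IN PRINT for d = 4; one finite four-torus programme at fixed ε — NOT infinite
volume, NOT OS on ℝ⁴, NOT a mass gap, NOT Clay.  0 `sorry`, 0 `def`, standard axioms.

References (TYPES only): [I] = [Balaban1987RG1] (0.23)–(0.25) pp. 256–257, §1 p. 263, p. 266, (2.12)–(2.13) p. 268; [II] = [Balaban1988RG2Cluster] (1.41) p. 11,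
(2.9)–(2.15) pp. 14–15, (2.26) p. 17, Lemma 3 p. 20, (2.39)–(2.41) p. 21.
-/

noncomputable section

open scoped Matrix.Norms.L2Operator

namespace YMDAG.N22.W1

open Set Metric
open scoped BigOperators
open Literature.MathematicalPhysics.QuantumFieldTheory.Balaban1983to89
open Literature.MathematicalPhysics.QuantumFieldTheory.Balaban1983to89.T4Continuum
open Literature.MathematicalPhysics.QuantumFieldTheory.Balaban1983to89.T4OutputRate
open Literature.MathematicalPhysics.QuantumFieldTheory.Balaban1983to89.TreeLengthTorus (TPt TDom tsys torusTreeLen torusTreeLen_nonneg)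
open Literature.MathematicalPhysics.QuantumFieldTheory.Balaban1983to89.B12TreeDecay (K₀ K₀_pos)
open Literature.MathematicalPhysics.QuantumFieldTheory.Balaban1983to89.B13Lemma3TorusData (TBond)
open Literature.MathematicalPhysics.QuantumFieldTheory.Balaban1983to89.B13Lemma3TorusTerms (terms weight weight_nonneg)
open Literature.MathematicalPhysics.QuantumFieldTheory.Balaban1983to89.B13Lemma3TorusSocket (Lemma3Numerics)
open Literature.MathematicalPhysics.QuantumFieldTheory.Balaban1983to89.Step (SFConsts)
open Literature.MathematicalPhysics.QuantumFieldTheory.Balaban1983to89.Node00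
  (Stage12Params Stage13Params IsDatumOfRecord₁₂C IsDatumOfRecord₁₃C U3Objects₁₁ U3Letters₁₁ NE2Objects₁₁ NE3Letters₁₁ MatA ιSU prependCoupling)
open Literature.MathematicalPhysics.QuantumFieldTheory.Balaban1983to89.Node00.Sect2 (domSys domCount CPair ofBackgroundC spaceI domSites Setting Residual)
open Literature.MathematicalPhysics.QuantumFieldTheory.Balaban1983to89.Node00.W1
open YMDAG.UVSplit

variable {N : ℕ} [NeZero N]

/-! ## §1 The θ-free engine for a generator identified at the run length with the (2.14) datum's -/

section TermDatumEq

variable {F : T4Family} {M : ℕ} [NeZero M] {L : ℕ} [NeZero L] (Gn : (k₁ : ℕ) → GenTower (F.P k₁) (MatA N) M)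
  (sp : (k j : ℕ) → (domSys (F.P k) M j).Dom → Set (CPair (F.P k) (MatA N)))
  (gauge : (k : ℕ) → GaugeField (F.P k) 0 (Node00.SU N) → GaugeField (F.P k) 0 (Node00.SU N) → ℝ) (hg : ∀ k U U', 0 ≤ gauge k U U')
  (T₀ : (k : ℕ) → GaugeField (F.P (k + 1)) 0 (Node00.SU N) → GaugeField (F.P k) 0 (Node00.SU N))
  (hT₀ : ∀ (k : ℕ) (U : GaugeField (F.P (k + 1)) 0 (Node00.SU N)),
    (∀ (j : ℕ) (Y : (domSys (F.P (k + 1)) M j).Dom), ofBackgroundC (ιSU N) U ∈ sp (k + 1) j Y) →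
    ∀ (j : ℕ) (Y : (domSys (F.P k) M j).Dom), ofBackgroundC (ιSU N) (T₀ k U) ∈ sp k j Y)
  (li : LetterInputs) (θ : Stage12Params F N) (k : ℕ) (c : B13.Consts) (𝔇 : TermData214 c (F.P k) (MatA N) M L) {G : Type*} [GaugeGroup G]
  (Sg : Setting (MatA N) G) (Rz : Residual (F.P k) (MatA N))

open Classical in
/-- **`N22At` AT THE ADMISSIBLE READING OF RECORD ON GENERATED RUN TOWERS WHOSE GENERATOR AT THE RUN LENGTH `k` IS THE (2.14) DATUM's** (`Gn k = 𝔇.Gn`; the other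
run lengths' generators free): node N18 below + `hspk` + numerals + signs + for `k′ < k`: Lemma 2's potentials `𝒱` of the datum LOCAL in the history on the space tables
(`PotentialsLocalOn` — W1 g7's law schema; gives (S-loc-T) by `TF_congr_old_of_potentialsLocalOn`) + (S-226-T) ∕ (S-last-T) FOR THE (2.14) TERM `(𝔇 k′).TF Z t` of every
`t ∈ terms L M Z` ([II] (2.26) + holomorphy, complex older terms ∕ complex last coupling — nodes N10 ∕ N09; the (2.26) halves = `norm_TF_le_weight_of_primitives` under its
located inputs) ⟹ `N22At (u3OfRecord₁₂ θ (Dr.u3Objects θ.γ) k)` (24′ §1 at `TF := 𝔇.TF`). [cite: Balaban1988RG2Cluster, (1.41) p.11, (2.9)-(2.15) pp.14-15, (2.26) p.17, Lemma 3 p.20 and (2.39)-(2.41) p.21; Balaban1987RG1, §1 p.263 and (2.12)-(2.13) p.268] -/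
theorem n22At_u3OfRecord₁₂_ofRecordAdm_runTowers_toClusterTower_of_n18Below_termDatum214 {cs : SFConsts} (hGn : Gn k = 𝔇.Gn)
    (hspk : ∀ (j : ℕ) (Y : (domSys (F.P k) M j).Dom), sp k j Y ⊆ spaceI Sg Rz M j (domSites (F.P k) M j Y) cs.α₀ cs.α₁)
    (hL : 8 ≤ c.L) (hLc : c.L = L) {a a₂ a₂' a₅ Aabs : ℝ}
    (hN : Lemma3Numerics c M ((c.L : ℝ) / 2) a a₂ a₂' a₅ Aabs) {r₁ : ℝ} (hA0 : 0 ≤ c.C3act * c.ε₁) (hr₁ : 0 ≤ r₁) (hκ : li.κ ≤ r₁)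
    (hrate : r₁ + 2 * (64 * Real.log 162) + 2 ≤ (1 - 8 * c.δ) * ((c.L : ℝ) / 2) * c.κ)
    (hsmall : c.C3act * c.ε₁ * Real.exp (5 * r₁ + 1) * K₀ 64 8 * 9 * 64 ≤ 1)
    (hrenew : Real.exp 1 * 9 * 64 * K₀ 64 8 ^ 2 * (c.C3act * c.ε₁) ≤ li.A)
    (hV : ∀ (k' : ℕ), k' < k → (𝔇 k').PotentialsLocalOn fun j Y => spaceI Sg Rz M j (domSites (F.P k) M j Y) cs.α₀ cs.α₁)
    (h226T : ∀ (k' : ℕ), k' < k → ∀ (D : Set ℂ), IsOpen D → (∀ t ∈ Ioc (0 : ℝ) θ.γ, closedBall (t : ℂ) li.r ⊆ D) → ∀ (s : ℝ), s ∈ Ioc (0 : ℝ) θ.γ →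
      ∀ (cv : ℂ → OlderTerms (F.P k) (MatA N) M k'),
      (∀ (j : Fin (k' + 1)) (Y : (domSys (F.P k) M j).Dom) (ψ : CPair (F.P k) (MatA N)), ψ ∈ spaceI Sg Rz M j (domSites (F.P k) M j Y) cs.α₀ cs.α₁ →
        DifferentiableOn ℂ (fun z => cv z j Y ψ) D ∧ ∀ z ∈ D, ‖cv z j Y ψ‖ ≤ li.A * Real.exp (-(li.κ * torusTreeLen Y.1))) →
      ∀ (X : (domSys (F.P k) M (k' + 1)).Dom) (φ : CPair (F.P k) (MatA N)), φ ∈ spaceI Sg Rz M (k' + 1) (domSites (F.P k) M (k' + 1) X) cs.α₀ cs.α₁ →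
      ∀ (Z : (domSys (F.P k) M (k' + 1)).Dom), Z.1 ⊆ X.1 → ∀ t ∈ terms L M Z,
        DifferentiableOn ℂ (fun z => (𝔇 k').TF Z t (s : ℂ) (cv z) φ) D ∧
        ∀ z ∈ D, ‖(𝔇 k').TF Z t (s : ℂ) (cv z) φ‖ ≤ weight L M c Z a t * Real.exp (a₅ * ((Z.1).card : ℝ)))
    (hlastT : ∀ (k' : ℕ), k' < k → ∀ (old : OlderTerms (F.P k) (MatA N) M k'), ∃ U : Set ℂ, IsOpen U ∧ (∀ t ∈ Ioc (0 : ℝ) θ.γ, closedBall (t : ℂ) li.r ⊆ U) ∧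
      ((∀ (j : Fin (k' + 1)) (Y : (domSys (F.P k) M j).Dom) (ψ : CPair (F.P k) (MatA N)), ψ ∈ spaceI Sg Rz M j (domSites (F.P k) M j Y) cs.α₀ cs.α₁ →
          ‖old j Y ψ‖ ≤ li.A * Real.exp (-(li.κ * torusTreeLen Y.1))) →
        ∀ (X : (domSys (F.P k) M (k' + 1)).Dom) (φ : CPair (F.P k) (MatA N)), φ ∈ spaceI Sg Rz M (k' + 1) (domSites (F.P k) M (k' + 1) X) cs.α₀ cs.α₁ →
          ∀ (Z : (domSys (F.P k) M (k' + 1)).Dom), Z.1 ⊆ X.1 → ∀ t ∈ terms L M Z,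
            DifferentiableOn ℂ (fun z => (𝔇 k').TF Z t z old φ) U ∧
            ∀ z ∈ U, ‖(𝔇 k').TF Z t z old φ‖ ≤ weight L M c Z a t * Real.exp (a₅ * ((Z.1).card : ℝ))))
    (h18 : ∀ k' : ℕ, k' < k →
      N18At (u3OfRecord₁₂ θ ((ReadingData.ofRecordAdm F M N (runTowers fun k₁ => toClusterTower (Gn k₁)) sp gauge hg T₀ hT₀ li).u3Objects θ.γ) k'))
    (hC5 : 0 ≤ li.C₅) (hθ1 : li.θ₅ < 1) (hC₀' : 2 * li.C₅ / (1 - li.θ₅) ≤ li.C₀)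
    (hC₀ : 0 < li.C₀) (hθ : 0 < li.θ₅) (hA : 0 < li.A) (hμ1 : 1 ≤ li.μ) (hθμ : li.θ₅ ≤ li.μ) (hCM : li.C₀ ≤ 2 * li.A)
    (hr : 0 < li.r) (hγ : 0 < θ.γ) (hs0 : 0 < li.s) (hs1 : li.s < 1) :
    N22At (u3OfRecord₁₂ θ ((ReadingData.ofRecordAdm F M N (runTowers fun k₁ => toClusterTower (Gn k₁)) sp gauge hg T₀ hT₀ li).u3Objects θ.γ) k) :=
  n22At_u3OfRecord₁₂_ofRecordAdm_runTowers_toClusterTower_of_n18Below_termFunEq Gn sp gauge hg T₀ hT₀ li θ k 𝔇.TF Sg Rz hGn hspk c hL hLc hN hA0 hr₁ hκ hrate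
    hsmall hrenew (fun k' hk t old old' φ Z h => (𝔇 k').TF_congr_old_of_potentialsLocalOn (hV k' hk) t old old' φ Z h) h226T hlastT h18 hC5 hθ1 hC₀' hC₀ hθ hA
    hμ1 hθμ hCM hr hγ hs0 hs1

end TermDatumEq

/-! ## §2 The same at one Stage-13 tuple -/

section TermDatumEq13

variable {F : T4Family} (θ : Stage13Params F N) {L : ℕ} [NeZero L] (Gn : (k₁ : ℕ) → GenTower (F.P k₁) (MatA N) θ.τ9.M)
  (sp : (k j : ℕ) → (domSys (F.P k) θ.τ9.M j).Dom → Set (CPair (F.P k) (MatA N)))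
  (gauge : (k : ℕ) → GaugeField (F.P k) 0 (Node00.SU N) → GaugeField (F.P k) 0 (Node00.SU N) → ℝ) (hg : ∀ k U U', 0 ≤ gauge k U U')
  (T₀ : (k : ℕ) → GaugeField (F.P (k + 1)) 0 (Node00.SU N) → GaugeField (F.P k) 0 (Node00.SU N))
  (hT₀ : ∀ (k : ℕ) (U : GaugeField (F.P (k + 1)) 0 (Node00.SU N)),
    (∀ (j : ℕ) (Y : (domSys (F.P (k + 1)) θ.τ9.M j).Dom), ofBackgroundC (ιSU N) U ∈ sp (k + 1) j Y) →
    ∀ (j : ℕ) (Y : (domSys (F.P k) θ.τ9.M j).Dom), ofBackgroundC (ιSU N) (T₀ k U) ∈ sp k j Y)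
  (li : LetterInputs) (k : ℕ) (c : B13.Consts) (𝔇 : TermData214 c (F.P k) (MatA N) θ.τ9.M L) {G : Type*} [GaugeGroup G]
  (Sg : Setting (MatA N) G) (Rz : Residual (F.P k) (MatA N))

open Classical in
/-- **§1 AT ONE STAGE-13 TUPLE** (`NeZero θ.τ9.M` from the context — e.g. `θ.Admissible`'s `1 ≤ τ9.M`; the Stage-13 bundle IS the Stage-12 bundle of `θ.toStage12Params`,
n22-e's `u3OfRecord₁₃_eq_u3OfRecord₁₂`, `rfl`). [cite: Balaban1988RG2Cluster, (2.9)-(2.15) pp.14-15, (2.26) p.17, Lemma 3 p.20 and (2.39)-(2.41) p.21; Balaban1987RG1, §1 p.263 and (2.12)-(2.13) p.268] -/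
theorem n22At_u3OfRecord₁₃_ofRecordAdm_runTowers_toClusterTower_of_n18Below_termDatum214 [NeZero θ.τ9.M] {cs : SFConsts}
    (hGn : Gn k = 𝔇.Gn)
    (hspk : ∀ (j : ℕ) (Y : (domSys (F.P k) θ.τ9.M j).Dom), sp k j Y ⊆ spaceI Sg Rz θ.τ9.M j (domSites (F.P k) θ.τ9.M j Y) cs.α₀ cs.α₁)
    (hL : 8 ≤ c.L) (hLc : c.L = L) {a a₂ a₂' a₅ Aabs : ℝ}
    (hN : Lemma3Numerics c θ.τ9.M ((c.L : ℝ) / 2) a a₂ a₂' a₅ Aabs) {r₁ : ℝ} (hA0 : 0 ≤ c.C3act * c.ε₁) (hr₁ : 0 ≤ r₁) (hκ : li.κ ≤ r₁)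
    (hrate : r₁ + 2 * (64 * Real.log 162) + 2 ≤ (1 - 8 * c.δ) * ((c.L : ℝ) / 2) * c.κ)
    (hsmall : c.C3act * c.ε₁ * Real.exp (5 * r₁ + 1) * K₀ 64 8 * 9 * 64 ≤ 1)
    (hrenew : Real.exp 1 * 9 * 64 * K₀ 64 8 ^ 2 * (c.C3act * c.ε₁) ≤ li.A)
    (hV : ∀ (k' : ℕ), k' < k → (𝔇 k').PotentialsLocalOn fun j Y => spaceI Sg Rz θ.τ9.M j (domSites (F.P k) θ.τ9.M j Y) cs.α₀ cs.α₁)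
    (h226T : ∀ (k' : ℕ), k' < k → ∀ (D : Set ℂ), IsOpen D → (∀ t ∈ Ioc (0 : ℝ) θ.γ, closedBall (t : ℂ) li.r ⊆ D) → ∀ (s : ℝ), s ∈ Ioc (0 : ℝ) θ.γ →
      ∀ (cv : ℂ → OlderTerms (F.P k) (MatA N) θ.τ9.M k'),
      (∀ (j : Fin (k' + 1)) (Y : (domSys (F.P k) θ.τ9.M j).Dom) (ψ : CPair (F.P k) (MatA N)),
        ψ ∈ spaceI Sg Rz θ.τ9.M j (domSites (F.P k) θ.τ9.M j Y) cs.α₀ cs.α₁ →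
        DifferentiableOn ℂ (fun z => cv z j Y ψ) D ∧ ∀ z ∈ D, ‖cv z j Y ψ‖ ≤ li.A * Real.exp (-(li.κ * torusTreeLen Y.1))) →
      ∀ (X : (domSys (F.P k) θ.τ9.M (k' + 1)).Dom) (φ : CPair (F.P k) (MatA N)),
      φ ∈ spaceI Sg Rz θ.τ9.M (k' + 1) (domSites (F.P k) θ.τ9.M (k' + 1) X) cs.α₀ cs.α₁ →
      ∀ (Z : (domSys (F.P k) θ.τ9.M (k' + 1)).Dom), Z.1 ⊆ X.1 → ∀ t ∈ terms L θ.τ9.M Z,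
        DifferentiableOn ℂ (fun z => (𝔇 k').TF Z t (s : ℂ) (cv z) φ) D ∧
        ∀ z ∈ D, ‖(𝔇 k').TF Z t (s : ℂ) (cv z) φ‖ ≤ weight L θ.τ9.M c Z a t * Real.exp (a₅ * ((Z.1).card : ℝ)))
    (hlastT : ∀ (k' : ℕ), k' < k → ∀ (old : OlderTerms (F.P k) (MatA N) θ.τ9.M k'), ∃ U : Set ℂ, IsOpen U ∧
      (∀ t ∈ Ioc (0 : ℝ) θ.γ, closedBall (t : ℂ) li.r ⊆ U) ∧
      ((∀ (j : Fin (k' + 1)) (Y : (domSys (F.P k) θ.τ9.M j).Dom) (ψ : CPair (F.P k) (MatA N)),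
          ψ ∈ spaceI Sg Rz θ.τ9.M j (domSites (F.P k) θ.τ9.M j Y) cs.α₀ cs.α₁ → ‖old j Y ψ‖ ≤ li.A * Real.exp (-(li.κ * torusTreeLen Y.1))) →
        ∀ (X : (domSys (F.P k) θ.τ9.M (k' + 1)).Dom) (φ : CPair (F.P k) (MatA N)),
        φ ∈ spaceI Sg Rz θ.τ9.M (k' + 1) (domSites (F.P k) θ.τ9.M (k' + 1) X) cs.α₀ cs.α₁ →
          ∀ (Z : (domSys (F.P k) θ.τ9.M (k' + 1)).Dom), Z.1 ⊆ X.1 → ∀ t ∈ terms L θ.τ9.M Z,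
            DifferentiableOn ℂ (fun z => (𝔇 k').TF Z t z old φ) U ∧
            ∀ z ∈ U, ‖(𝔇 k').TF Z t z old φ‖ ≤ weight L θ.τ9.M c Z a t * Real.exp (a₅ * ((Z.1).card : ℝ))))
    (h18 : ∀ k' : ℕ, k' < k →
      N18At (u3OfRecord₁₃ θ ((ReadingData.ofRecordAdm F θ.τ9.M N (runTowers fun k₁ => toClusterTower (Gn k₁)) sp gauge hg T₀ hT₀ li).u3Objects θ.γ) k'))
    (hC5 : 0 ≤ li.C₅) (hθ1 : li.θ₅ < 1) (hC₀' : 2 * li.C₅ / (1 - li.θ₅) ≤ li.C₀)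
    (hC₀ : 0 < li.C₀) (hθ5 : 0 < li.θ₅) (hA : 0 < li.A) (hμ1 : 1 ≤ li.μ) (hθμ : li.θ₅ ≤ li.μ) (hCM : li.C₀ ≤ 2 * li.A)
    (hr : 0 < li.r) (hγ : 0 < θ.γ) (hs0 : 0 < li.s) (hs1 : li.s < 1) :
    N22At (u3OfRecord₁₃ θ ((ReadingData.ofRecordAdm F θ.τ9.M N (runTowers fun k₁ => toClusterTower (Gn k₁)) sp gauge hg T₀ hT₀ li).u3Objects θ.γ) k) := by
  rw [u3OfRecord₁₃_eq_u3OfRecord₁₂]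
  exact n22At_u3OfRecord₁₂_ofRecordAdm_runTowers_toClusterTower_of_n18Below_termDatum214 Gn sp gauge hg T₀ hT₀ li θ.toStage12Params k c 𝔇 Sg Rz hGn hspk hL hLc hN
    hA0 hr₁ hκ hrate hsmall hrenew hV h226T hlastT (fun k' hk => by rw [← u3OfRecord₁₃_eq_u3OfRecord₁₂]; exact h18 k' hk) hC5 hθ1 hC₀' hC₀ hθ5 hA hμ1 hθμ hCM hr
    hγ hs0 hs1

end TermDatumEq13

/-! ## §3 IN THE K3‴ SKELETON's OWN CURRENCY: N22's conjunct of `KeyedRates rr` at the level-selected tuple reading of record, from the (2.14) datum -/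

section TupleReading

variable (Gn : (F : T4Family) → (θ : Stage13Params F N) → (k : ℕ) → GenTower (F.P k) (MatA N) θ.τ9.M)
  (sp : (F : T4Family) → (θ : Stage13Params F N) → (k j : ℕ) → (domSys (F.P k) θ.τ9.M j).Dom → Set (CPair (F.P k) (MatA N)))
  (gauge : (F : T4Family) → (θ : Stage13Params F N) → (k : ℕ) → GaugeField (F.P k) 0 (Node00.SU N) → GaugeField (F.P k) 0 (Node00.SU N) → ℝ)
  (hg : ∀ (F : T4Family) (θ : Stage13Params F N) (k : ℕ) (U U' : GaugeField (F.P k) 0 (Node00.SU N)), 0 ≤ gauge F θ k U U')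
  (T₀ : (F : T4Family) → (θ : Stage13Params F N) → (k : ℕ) → GaugeField (F.P (k + 1)) 0 (Node00.SU N) → GaugeField (F.P k) 0 (Node00.SU N))
  (hT : ∀ (F : T4Family) (θ : Stage13Params F N) (k : ℕ) (U : GaugeField (F.P (k + 1)) 0 (Node00.SU N)),
    (∀ (j : ℕ) (Y : (domSys (F.P (k + 1)) θ.τ9.M j).Dom), ofBackgroundC (ιSU N) U ∈ sp F θ (k + 1) j Y) →
      ∀ (j : ℕ) (X : (domSys (F.P k) θ.τ9.M j).Dom), ofBackgroundC (ιSU N) (T₀ F θ k U) ∈ sp F θ k j X)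
  (li : (F : T4Family) → Stage13Params F N → LetterInputs) (ℓ₃ : T4Family → NE3Letters₁₁)
  (ne2 : (F : T4Family) → Stage13Params F N → (ℕ → ℝ) → List (ULoop F) → ℕ → NE2Objects₁₁)
  (ne1 : (F : T4Family) → Stage13Params F N → (ℕ → ℝ) → List (ULoop F) → NE1pCarriers)
  (ksel : (F : T4Family) → Stage13Params F N → (ℕ → ℝ) → List (ULoop F) → ℕ)
  (Rg : (F : T4Family) → Stage13Params F N → Prop) {G : Type*} [GaugeGroup G]

open Classical in
/-- **N22's CONJUNCT OF `KeyedRates rr` AT THE LEVEL-SELECTED TUPLE READING OF RECORD ON THE GENERATED ADMISSIBLE RUN TOWERS, FROM THE (2.14) DATUM, GUARDED BY ANY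
REGIME `Rg`**: for `rr F θ hP g₀ os := rateCarriersOfRecord₁₃ (readingOfRecord₁₃ (fun F θ ↦ ReadingData.ofRecordAdm F θ.τ9.M N (runTowers fun k ↦ toClusterTower (Gn F θ k)) …)
ℓ₃ ne2 ne1) F θ hP g₀ os (ksel F θ g₀ os)`, node N18 at the run lengths BELOW the selected one at the same reading + the letter signs + per `(F, θ, g₀, os)` in the regime
∃(`NeZero θ.τ9.M`, `Sg`, `Rz`, `cs`, `c`, `L`, `NeZero L`, `a … r₁`, a (2.14) term-datum family `𝔇 : W1.TermData214 c (F.P (ksel …)) (M_N ℂ) θ.τ9.M L`):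
`Gn F θ (ksel …) = 𝔇.Gn` ∧ `hspk` ∧ numerals ∧ `(𝔇 k′).PotentialsLocalOn (U^c-tables)` ∧ (S-226-T) ∧ (S-last-T) FOR `(𝔇 k′).TF` below the selected run length ⟹
`∀ F θ hP, Rg F θ → θ.Admissible F N → ∀ g₀ os, N22At (rr F θ hP g₀ os).u3` (§2 once per tuple; `readingOfRecord₁₃_bundle_u3`, `rfl`).  ONE conjunct of six — NOT a closer of
`stub_rates13`. [cite: Balaban1988RG2Cluster, (1.41) p.11, (2.9)-(2.15) pp.14-15, (2.26) p.17, Lemma 3 p.20 and (2.39)-(2.41) p.21; Balaban1987RG1, (0.23)-(0.25) pp.256-257, §1 p.263 and (2.12)-(2.13) p.268] -/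
theorem n22_tupleReadingOfRecordOn_termDatum214_of_n18Below_potentialsLocal
    (h18 : ∀ (F : T4Family) (θ : Stage13Params F N) (hP : θ.Provisos₁₃ F N), Rg F θ → θ.Admissible F N → ∀ (g₀ : ℕ → ℝ) (os : List (ULoop F)),
      ∀ k' : ℕ, k' < ksel F θ g₀ os → N18At (u3OfRecord₁₃ θ ((ReadingData.ofRecordAdm F θ.τ9.M N (runTowers fun k => toClusterTower (Gn F θ k)) (sp F θ)
        (gauge F θ) (hg F θ) (T₀ F θ) (hT F θ) (li F θ)).u3Objects θ.γ) k'))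
    (hnum : ∀ (F : T4Family) (θ : Stage13Params F N), θ.Provisos₁₃ F N → Rg F θ → θ.Admissible F N →
      0 < (li F θ).C₀ ∧ 0 < (li F θ).θ₅ ∧ (li F θ).θ₅ < 1 ∧ 0 ≤ (li F θ).C₅ ∧ 2 * (li F θ).C₅ / (1 - (li F θ).θ₅) ≤ (li F θ).C₀ ∧ 0 < (li F θ).A ∧
        (li F θ).θ₅ ≤ (li F θ).μ ∧ (li F θ).C₀ ≤ 2 * (li F θ).A ∧ 0 < (li F θ).r ∧ 0 < (li F θ).s ∧ (li F θ).s < 1 ∧ 1 ≤ (li F θ).μ)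
    (hdata : ∀ (F : T4Family) (θ : Stage13Params F N), θ.Provisos₁₃ F N → Rg F θ → θ.Admissible F N → ∀ (g₀ : ℕ → ℝ) (os : List (ULoop F)),
      ∃ (_ : NeZero θ.τ9.M) (Sg : Setting (MatA N) G) (Rz : Residual (F.P (ksel F θ g₀ os)) (MatA N))
        (cs : SFConsts) (c : B13.Consts) (L : ℕ) (_ : NeZero L) (a a₂ a₂' a₅ Aabs r₁ : ℝ) (𝔇 : TermData214 c (F.P (ksel F θ g₀ os)) (MatA N) θ.τ9.M L),
        Gn F θ (ksel F θ g₀ os) = 𝔇.Gn ∧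
        (∀ (j : ℕ) (Y : (domSys (F.P (ksel F θ g₀ os)) θ.τ9.M j).Dom),
          sp F θ (ksel F θ g₀ os) j Y ⊆ spaceI Sg Rz θ.τ9.M j (domSites (F.P (ksel F θ g₀ os)) θ.τ9.M j Y) cs.α₀ cs.α₁) ∧
        8 ≤ c.L ∧ c.L = L ∧ Lemma3Numerics c θ.τ9.M ((c.L : ℝ) / 2) a a₂ a₂' a₅ Aabs ∧ 0 ≤ c.C3act * c.ε₁ ∧ 0 ≤ r₁ ∧ (li F θ).κ ≤ r₁ ∧
        r₁ + 2 * (64 * Real.log 162) + 2 ≤ (1 - 8 * c.δ) * ((c.L : ℝ) / 2) * c.κ ∧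
        c.C3act * c.ε₁ * Real.exp (5 * r₁ + 1) * K₀ 64 8 * 9 * 64 ≤ 1 ∧
        Real.exp 1 * 9 * 64 * K₀ 64 8 ^ 2 * (c.C3act * c.ε₁) ≤ (li F θ).A ∧
        (∀ (k' : ℕ), k' < ksel F θ g₀ os →
          (𝔇 k').PotentialsLocalOn fun j Y => spaceI Sg Rz θ.τ9.M j (domSites (F.P (ksel F θ g₀ os)) θ.τ9.M j Y) cs.α₀ cs.α₁) ∧
        (∀ (k' : ℕ), k' < ksel F θ g₀ os → ∀ (D : Set ℂ), IsOpen D → (∀ t ∈ Ioc (0 : ℝ) θ.γ, closedBall (t : ℂ) (li F θ).r ⊆ D) →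
          ∀ (s : ℝ), s ∈ Ioc (0 : ℝ) θ.γ → ∀ (cv : ℂ → OlderTerms (F.P (ksel F θ g₀ os)) (MatA N) θ.τ9.M k'),
          (∀ (j : Fin (k' + 1)) (Y : (domSys (F.P (ksel F θ g₀ os)) θ.τ9.M j).Dom) (ψ : CPair (F.P (ksel F θ g₀ os)) (MatA N)),
            ψ ∈ spaceI Sg Rz θ.τ9.M j (domSites (F.P (ksel F θ g₀ os)) θ.τ9.M j Y) cs.α₀ cs.α₁ →
            DifferentiableOn ℂ (fun z => cv z j Y ψ) D ∧ ∀ z ∈ D, ‖cv z j Y ψ‖ ≤ (li F θ).A * Real.exp (-((li F θ).κ * torusTreeLen Y.1))) →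
          ∀ (X : (domSys (F.P (ksel F θ g₀ os)) θ.τ9.M (k' + 1)).Dom) (φ : CPair (F.P (ksel F θ g₀ os)) (MatA N)),
          φ ∈ spaceI Sg Rz θ.τ9.M (k' + 1) (domSites (F.P (ksel F θ g₀ os)) θ.τ9.M (k' + 1) X) cs.α₀ cs.α₁ →
          ∀ (Z : (domSys (F.P (ksel F θ g₀ os)) θ.τ9.M (k' + 1)).Dom), Z.1 ⊆ X.1 → ∀ t ∈ terms L θ.τ9.M Z,
            DifferentiableOn ℂ (fun z => (𝔇 k').TF Z t (s : ℂ) (cv z) φ) D ∧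
            ∀ z ∈ D, ‖(𝔇 k').TF Z t (s : ℂ) (cv z) φ‖ ≤ weight L θ.τ9.M c Z a t * Real.exp (a₅ * ((Z.1).card : ℝ))) ∧
        (∀ (k' : ℕ), k' < ksel F θ g₀ os → ∀ (old : OlderTerms (F.P (ksel F θ g₀ os)) (MatA N) θ.τ9.M k'), ∃ U : Set ℂ, IsOpen U ∧
          (∀ t ∈ Ioc (0 : ℝ) θ.γ, closedBall (t : ℂ) (li F θ).r ⊆ U) ∧
          ((∀ (j : Fin (k' + 1)) (Y : (domSys (F.P (ksel F θ g₀ os)) θ.τ9.M j).Dom) (ψ : CPair (F.P (ksel F θ g₀ os)) (MatA N)),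
              ψ ∈ spaceI Sg Rz θ.τ9.M j (domSites (F.P (ksel F θ g₀ os)) θ.τ9.M j Y) cs.α₀ cs.α₁ →
              ‖old j Y ψ‖ ≤ (li F θ).A * Real.exp (-((li F θ).κ * torusTreeLen Y.1))) →
            ∀ (X : (domSys (F.P (ksel F θ g₀ os)) θ.τ9.M (k' + 1)).Dom) (φ : CPair (F.P (ksel F θ g₀ os)) (MatA N)),
            φ ∈ spaceI Sg Rz θ.τ9.M (k' + 1) (domSites (F.P (ksel F θ g₀ os)) θ.τ9.M (k' + 1) X) cs.α₀ cs.α₁ →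
            ∀ (Z : (domSys (F.P (ksel F θ g₀ os)) θ.τ9.M (k' + 1)).Dom), Z.1 ⊆ X.1 → ∀ t ∈ terms L θ.τ9.M Z,
              DifferentiableOn ℂ (fun z => (𝔇 k').TF Z t z old φ) U ∧
              ∀ z ∈ U, ‖(𝔇 k').TF Z t z old φ‖ ≤ weight L θ.τ9.M c Z a t * Real.exp (a₅ * ((Z.1).card : ℝ))))) :
    ∀ (F : T4Family) (θ : Stage13Params F N) (hP : θ.Provisos₁₃ F N), Rg F θ → θ.Admissible F N → ∀ (g₀ : ℕ → ℝ) (os : List (ULoop F)),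
      N22At (rateCarriersOfRecord₁₃ (readingOfRecord₁₃ (fun F θ => ReadingData.ofRecordAdm F θ.τ9.M N (runTowers fun k => toClusterTower (Gn F θ k)) (sp F θ)
        (gauge F θ) (hg F θ) (T₀ F θ) (hT F θ) (li F θ)) ℓ₃ ne2 ne1) F θ hP g₀ os (ksel F θ g₀ os)).u3 := by
  intro F θ hP hRg hθ g₀ os
  obtain ⟨hC₀, hθ5, hθ1, hC5, hC₀', hA, hθμ, hCM, hr, hs0, hs1, hμ1⟩ := hnum F θ hP hRg hθ
  obtain ⟨hMz, Sg, Rz, cs, c, L, hLz, a, a₂, a₂', a₅, Aabs, r₁, 𝔇, hGn, hspk, hL, hLc, hN, hA0, hr₁, hκ, hrate, hsmall, hrenew, hV, h226T, hlastT⟩ :=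
    hdata F θ hP hRg hθ g₀ os
  rw [readingOfRecord₁₃_bundle_u3]
  exact n22At_u3OfRecord₁₃_ofRecordAdm_runTowers_toClusterTower_of_n18Below_termDatum214 θ (Gn F θ) (sp F θ) (gauge F θ) (hg F θ) (T₀ F θ) (hT F θ) (li F θ)
    (ksel F θ g₀ os) c 𝔇 Sg Rz hGn hspk hL hLc hN hA0 hr₁ hκ hrate hsmall hrenew hV h226T hlastT (h18 F θ hP hRg hθ g₀ os) hC5 hθ1 hC₀' hC₀ hθ5 hA hμ1 hθμ hCM
    hr hθ.toStage9.gamma_pos hs0 hs1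

open Classical in
/-- **… UNGUARDED** (the skeleton's binder «`∀ F θ hP, θ.Admissible F N → ∀ g₀ os, N22At (rr F θ hP g₀ os).u3`» verbatim: the guarded form at `Rg := fun _ _ ↦ True`).
[cite: Balaban1988RG2Cluster, (2.9)-(2.15) pp.14-15, (2.26) p.17, Lemma 3 p.20 and (2.39)-(2.41) p.21; Balaban1987RG1, (0.23)-(0.25) pp.256-257, §1 p.263 and (2.12)-(2.13) p.268] -/
theorem n22_tupleReadingOfRecord_termDatum214_of_n18Below_potentialsLocal
    (h18 : ∀ (F : T4Family) (θ : Stage13Params F N) (hP : θ.Provisos₁₃ F N), θ.Admissible F N → ∀ (g₀ : ℕ → ℝ) (os : List (ULoop F)),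
      ∀ k' : ℕ, k' < ksel F θ g₀ os → N18At (u3OfRecord₁₃ θ ((ReadingData.ofRecordAdm F θ.τ9.M N (runTowers fun k => toClusterTower (Gn F θ k)) (sp F θ)
        (gauge F θ) (hg F θ) (T₀ F θ) (hT F θ) (li F θ)).u3Objects θ.γ) k'))
    (hnum : ∀ (F : T4Family) (θ : Stage13Params F N), θ.Provisos₁₃ F N → θ.Admissible F N →
      0 < (li F θ).C₀ ∧ 0 < (li F θ).θ₅ ∧ (li F θ).θ₅ < 1 ∧ 0 ≤ (li F θ).C₅ ∧ 2 * (li F θ).C₅ / (1 - (li F θ).θ₅) ≤ (li F θ).C₀ ∧ 0 < (li F θ).A ∧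
        (li F θ).θ₅ ≤ (li F θ).μ ∧ (li F θ).C₀ ≤ 2 * (li F θ).A ∧ 0 < (li F θ).r ∧ 0 < (li F θ).s ∧ (li F θ).s < 1 ∧ 1 ≤ (li F θ).μ)
    (hdata : ∀ (F : T4Family) (θ : Stage13Params F N), θ.Provisos₁₃ F N → θ.Admissible F N → ∀ (g₀ : ℕ → ℝ) (os : List (ULoop F)),
      ∃ (_ : NeZero θ.τ9.M) (Sg : Setting (MatA N) G) (Rz : Residual (F.P (ksel F θ g₀ os)) (MatA N))
        (cs : SFConsts) (c : B13.Consts) (L : ℕ) (_ : NeZero L) (a a₂ a₂' a₅ Aabs r₁ : ℝ) (𝔇 : TermData214 c (F.P (ksel F θ g₀ os)) (MatA N) θ.τ9.M L),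
        Gn F θ (ksel F θ g₀ os) = 𝔇.Gn ∧
        (∀ (j : ℕ) (Y : (domSys (F.P (ksel F θ g₀ os)) θ.τ9.M j).Dom),
          sp F θ (ksel F θ g₀ os) j Y ⊆ spaceI Sg Rz θ.τ9.M j (domSites (F.P (ksel F θ g₀ os)) θ.τ9.M j Y) cs.α₀ cs.α₁) ∧
        8 ≤ c.L ∧ c.L = L ∧ Lemma3Numerics c θ.τ9.M ((c.L : ℝ) / 2) a a₂ a₂' a₅ Aabs ∧ 0 ≤ c.C3act * c.ε₁ ∧ 0 ≤ r₁ ∧ (li F θ).κ ≤ r₁ ∧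
        r₁ + 2 * (64 * Real.log 162) + 2 ≤ (1 - 8 * c.δ) * ((c.L : ℝ) / 2) * c.κ ∧
        c.C3act * c.ε₁ * Real.exp (5 * r₁ + 1) * K₀ 64 8 * 9 * 64 ≤ 1 ∧
        Real.exp 1 * 9 * 64 * K₀ 64 8 ^ 2 * (c.C3act * c.ε₁) ≤ (li F θ).A ∧
        (∀ (k' : ℕ), k' < ksel F θ g₀ os →
          (𝔇 k').PotentialsLocalOn fun j Y => spaceI Sg Rz θ.τ9.M j (domSites (F.P (ksel F θ g₀ os)) θ.τ9.M j Y) cs.α₀ cs.α₁) ∧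
        (∀ (k' : ℕ), k' < ksel F θ g₀ os → ∀ (D : Set ℂ), IsOpen D → (∀ t ∈ Ioc (0 : ℝ) θ.γ, closedBall (t : ℂ) (li F θ).r ⊆ D) →
          ∀ (s : ℝ), s ∈ Ioc (0 : ℝ) θ.γ → ∀ (cv : ℂ → OlderTerms (F.P (ksel F θ g₀ os)) (MatA N) θ.τ9.M k'),
          (∀ (j : Fin (k' + 1)) (Y : (domSys (F.P (ksel F θ g₀ os)) θ.τ9.M j).Dom) (ψ : CPair (F.P (ksel F θ g₀ os)) (MatA N)),
            ψ ∈ spaceI Sg Rz θ.τ9.M j (domSites (F.P (ksel F θ g₀ os)) θ.τ9.M j Y) cs.α₀ cs.α₁ →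
            DifferentiableOn ℂ (fun z => cv z j Y ψ) D ∧ ∀ z ∈ D, ‖cv z j Y ψ‖ ≤ (li F θ).A * Real.exp (-((li F θ).κ * torusTreeLen Y.1))) →
          ∀ (X : (domSys (F.P (ksel F θ g₀ os)) θ.τ9.M (k' + 1)).Dom) (φ : CPair (F.P (ksel F θ g₀ os)) (MatA N)),
          φ ∈ spaceI Sg Rz θ.τ9.M (k' + 1) (domSites (F.P (ksel F θ g₀ os)) θ.τ9.M (k' + 1) X) cs.α₀ cs.α₁ →
          ∀ (Z : (domSys (F.P (ksel F θ g₀ os)) θ.τ9.M (k' + 1)).Dom), Z.1 ⊆ X.1 → ∀ t ∈ terms L θ.τ9.M Z,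
            DifferentiableOn ℂ (fun z => (𝔇 k').TF Z t (s : ℂ) (cv z) φ) D ∧
            ∀ z ∈ D, ‖(𝔇 k').TF Z t (s : ℂ) (cv z) φ‖ ≤ weight L θ.τ9.M c Z a t * Real.exp (a₅ * ((Z.1).card : ℝ))) ∧
        (∀ (k' : ℕ), k' < ksel F θ g₀ os → ∀ (old : OlderTerms (F.P (ksel F θ g₀ os)) (MatA N) θ.τ9.M k'), ∃ U : Set ℂ, IsOpen U ∧
          (∀ t ∈ Ioc (0 : ℝ) θ.γ, closedBall (t : ℂ) (li F θ).r ⊆ U) ∧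
          ((∀ (j : Fin (k' + 1)) (Y : (domSys (F.P (ksel F θ g₀ os)) θ.τ9.M j).Dom) (ψ : CPair (F.P (ksel F θ g₀ os)) (MatA N)),
              ψ ∈ spaceI Sg Rz θ.τ9.M j (domSites (F.P (ksel F θ g₀ os)) θ.τ9.M j Y) cs.α₀ cs.α₁ →
              ‖old j Y ψ‖ ≤ (li F θ).A * Real.exp (-((li F θ).κ * torusTreeLen Y.1))) →
            ∀ (X : (domSys (F.P (ksel F θ g₀ os)) θ.τ9.M (k' + 1)).Dom) (φ : CPair (F.P (ksel F θ g₀ os)) (MatA N)),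
            φ ∈ spaceI Sg Rz θ.τ9.M (k' + 1) (domSites (F.P (ksel F θ g₀ os)) θ.τ9.M (k' + 1) X) cs.α₀ cs.α₁ →
            ∀ (Z : (domSys (F.P (ksel F θ g₀ os)) θ.τ9.M (k' + 1)).Dom), Z.1 ⊆ X.1 → ∀ t ∈ terms L θ.τ9.M Z,
              DifferentiableOn ℂ (fun z => (𝔇 k').TF Z t z old φ) U ∧
              ∀ z ∈ U, ‖(𝔇 k').TF Z t z old φ‖ ≤ weight L θ.τ9.M c Z a t * Real.exp (a₅ * ((Z.1).card : ℝ))))) :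
    ∀ (F : T4Family) (θ : Stage13Params F N) (hP : θ.Provisos₁₃ F N), θ.Admissible F N → ∀ (g₀ : ℕ → ℝ) (os : List (ULoop F)),
      N22At (rateCarriersOfRecord₁₃ (readingOfRecord₁₃ (fun F θ => ReadingData.ofRecordAdm F θ.τ9.M N (runTowers fun k => toClusterTower (Gn F θ k)) (sp F θ)
        (gauge F θ) (hg F θ) (T₀ F θ) (hT F θ) (li F θ)) ℓ₃ ne2 ne1) F θ hP g₀ os (ksel F θ g₀ os)).u3 :=
  fun F θ hP hθ g₀ os =>
    n22_tupleReadingOfRecordOn_termDatum214_of_n18Below_potentialsLocal Gn sp gauge hg T₀ hT li ℓ₃ ne2 ne1 ksel (fun _ _ => True) (G := G)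
      (fun F θ hP _ hθ => h18 F θ hP hθ) (fun F θ hP _ hθ => hnum F θ hP hθ) (fun F θ hP _ hθ => hdata F θ hP hθ) F θ hP trivial hθ g₀ os

end TupleReading

end YMDAG.N22.W1

end
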